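import Literature.Geometry.Lorentzian.RicciChartDecay
import Literature.Geometry.Lorentzian.RicciVariationFamily
import Literature.Geometry.Lorentzian.MetricComparison
import Literature.Geometry.Lorentzian.MetricDetComparison
import Literature.Geometry.Lorentzian.RiemannianMeasureComparison
import Literature.Geometry.Lorentzian.AFSobolev
import HarnessLib

/-!
# Uniform constants along the Ricci variation `ds²_t = ds² + t Ric` (Schoen–Yau 1979, p. 73)

In the proof of Thm. 2 of Schoen–Yau, Comm. Math. Phys. 65 (1979), pp. 72–74, the linear theory of
Lemmas 3.1–3.3 is applied to every metric of the family `ds²_t = ds² + t Ric` near `t = 0`, and the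
differentiation of the mass integral ((3.27)–(3.30)) uses that *"the estimates (3.28) hold
uniformly for `t` small"* ((3.28)–(3.29), p. 73). The source of this uniformity is elementary:
since `|Ric(v, v)| ≤ C ds²(v, v)` globally (`AFEnd.exists_bound_abs_ricci_le`), for `|t| C ≤ 1/2`
the metrics `ds²_t` are uniformly equivalent to `ds²`, `(1 − |t|C) ds² ≤ ds²_t ≤ (1 + |t|C) ds²`,
hence have comparable volumes, inverse metrics and Sobolev constants. This file proves:

* `IsAsymptoticallySchwarzschild.isMetricAsymptoticallyFlat_two` — an end with the Schoen–Yau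
  expansion (1.1) of mass `0` to `nh ≥ 2` derivatives is metrically asymptotically flat of order
  `2` (`h − δ = O₂(r⁻²)`); in particular every `ds²_t` is (`RicciChartDecay.lean`);
* `ricciFamily_val_mem_Icc` — `(1 − |t|C) h(v,v) ≤ h_t(v,v) ≤ (1 + |t|C) h(v,v)`;
* `riemannianMeasure_ricciFamily_eq_withDensity` — `dV_t = ρ_t dV` with the continuous
  density `ρ_t = √det(♯_h ∘ ♭_{h_t})` satisfying `(1 − |t|C)^{3/2} ≤ ρ_t ≤ (1 + |t|C)^{3/2}`
  (`RiemannianMeasureComparison.lean`, `MetricDetComparison.lean`), so that `ρ_t → 1` uniformly;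
* `AFEnd.exists_uniform_constants_ricciFamily` — **the package**: `τ₁ ∈ (0, τ]` with
  `τ₁ C ≤ 1/2` and a constant `c₁` such that for `|t| < τ₁`: the two-sided comparison of `h_t`
  with `h`, `dV_t ≤ 2 dV`, `dV ≤ 3 dV_t`, the density bounds, and the Sobolev inequality
  `(∫ |ζ|⁶ dV_t)^{1/3} ≤ c₁ ∫ h_t⁻¹(dζ, dζ) dV_t` for all `ζ ∈ C¹_c(X)` with `c₁` independent of `t`
  (Lemma 3.1 for `ds²` (`AFEnd.sobolev_inequality`) transferred by `sobolev_of_uniformlyEquivalent`).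

All results are proved; no definitions and no named facts are introduced.

## References

* R. Schoen, S.-T. Yau, *On the proof of the positive mass conjecture in general relativity*,
  Comm. Math. Phys. 65 (1979) 45–76: the family `ds²_t` (p. 72), (3.28)–(3.29) (p. 73),
  Lemma 3.1 (p. 63).
-/

noncomputable section

open Set Function Filter MeasureTheory Measure TopologicalSpace Manifold Bundle Module Bornology
  Asymptotics
open scoped Topology Manifold ContDiff ENNReal

namespace Literature.Geometry.Lorentzian

open PseudoRiemannianMetric

variable {X : Type} [TopologicalSpace X] [ChartedSpace E3 X] [IsManifold (𝓡 3) ∞ X]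

/-! ### Mass-zero Schoen–Yau ends are metrically asymptotically flat of order `2` -/

/-- **`h = δ + O_{nh}(r⁻²)` with `nh ≥ 2` gives `h − δ = O₂(r⁻²)`**: the Schoen–Yau expansion
(1.1) with mass `0` to `nh ≥ 2` derivatives is metric asymptotic flatness of order `2` (the leading
term `(1 + 0/(2r))⁴ δ` is `δ`). Applies to every metric `ds² + t Ric` of the Ricci variation
(`ricciVariation_isAsymptoticallySchwarzschild`). [cite: SchoenYauPMT1979, §1 (1.1)] -/
theorem IsAsymptoticallySchwarzschild.isMetricAsymptoticallyFlat_two {e : AFEnd X}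
    {D : InitialDataSet (𝓡 3) X} {nh : ℕ} (h : IsAsymptoticallySchwarzschild e D 0 nh)
    (hnh : 2 ≤ nh) : e.IsMetricAsymptoticallyFlat D 2 := by
  intro m hm
  have hm' := h m (hm.trans hnh)
  have hfun : (fun y : E3 ↦ AFEnd.hCoeff e D y -
      (1 + (0 : ℝ) / (2 * ‖y‖)) ^ 4 • (innerSL ℝ : E3 →L[ℝ] E3 →L[ℝ] ℝ)) =
      fun y ↦ AFEnd.hCoeff e D y - (innerSL ℝ : E3 →L[ℝ] E3 →L[ℝ] ℝ) := by
    funext y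
    rw [zero_div, add_zero, one_pow, one_smul]
  rw [hfun] at hm'
  refine hm'.congr_right fun x ↦ ?_
  norm_num

section Family

variable (D : InitialDataSet (𝓡 3) X)

/-! ### Pointwise comparison of `h_t = h + t Ric` with `h` -/

/-- **`(1 − |t|C) h(v,v) ≤ h_t(v,v) ≤ (1 + |t|C) h(v,v)`** for a metric with
`h_t(v,w) = h(v,w) + t Ric(v,w)` and a bound `|Ric(v,v)| ≤ C h(v,v)`.
[cite: SchoenYauPMT1979, §3 p. 72] -/
theorem ricciFamily_val_mem_Icc [D.metric.HasLeviCivita] {C : ℝ}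
    (hC : ∀ (x : X) (v : TangentSpace (𝓡 3) x), |D.metric.ricci x v v| ≤ C * D.metric.val x v v)
    {D₂ : InitialDataSet (𝓡 3) X} {t : ℝ}
    (hval : ∀ (x : X) (v w : TangentSpace (𝓡 3) x),
      D₂.metric.val x v w = D.metric.val x v w + t * D.metric.ricci x v w)
    (x : X) (v : TangentSpace (𝓡 3) x) :
    (1 - |t| * C) * D.metric.val x v v ≤ D₂.metric.val x v v ∧
      D₂.metric.val x v v ≤ (1 + |t| * C) * D.metric.val x v v := by
  rw [hval x v v]
  have h1 := hC x v
  have h2 : |t * D.metric.ricci x v v| ≤ |t| * (C * D.metric.val x v v) := by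
    rw [abs_mul]
    exact mul_le_mul_of_nonneg_left h1 (abs_nonneg t)
  have h3 := neg_abs_le (t * D.metric.ricci x v v)
  have h4 := le_abs_self (t * D.metric.ricci x v v)
  constructor <;> nlinarith

/-! ### The volume density of `h_t` -/

variable [T2Space X] [LocallyCompactSpace X] [SecondCountableTopology X] [MeasurableSpace X]
  [BorelSpace X]

/-- **`dV_t = ρ_t dV` with `(1 − |t|C)^{3/2} ≤ ρ_t ≤ (1 + |t|C)^{3/2}`** along the Ricci
variation: for data `D₂` with metric `h + t Ric` pointwise, `|Ric(v,v)| ≤ C h(v,v)` and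
`|t| C ≤ 1`, the Riemannian measure of `D₂` is that of `D` with the continuous density
`ρ_t = √det(♯_h ∘ ♭_{h_t})` (`riemannianMeasure_eq_withDensity_sqrt_det_endo`), and
`(1 − |t|C)³ ≤ det(♯_h ∘ ♭_{h_t}) ≤ (1 + |t|C)³` (`det_sharp_comp_toBilinForm_mem_Icc`). This is
the uniformity of the volume elements `√g_t` in (3.27)–(3.29) of Schoen–Yau 1979.
[cite: SchoenYauPMT1979, (3.27)–(3.29) (p. 73)] -/
theorem riemannianMeasure_ricciFamily_eq_withDensity [D.metric.HasLeviCivita] {C : ℝ}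
    (hC : ∀ (x : X) (v : TangentSpace (𝓡 3) x), |D.metric.ricci x v v| ≤ C * D.metric.val x v v)
    {D₂ : InitialDataSet (𝓡 3) X} {t : ℝ} (ht : |t| * C ≤ 1)
    (hval : ∀ (x : X) (v w : TangentSpace (𝓡 3) x),
      D₂.metric.val x v w = D.metric.val x v w + t * D.metric.ricci x v w) :
    riemannianMeasure D₂.h = (riemannianMeasure D.h).withDensity (fun p ↦ ENNReal.ofReal
      (Real.sqrt (LinearMap.det ((D.metric.sharp p).toLinearMap ∘ₗ D₂.metric.toBilinForm p)))) ∧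
    Continuous (fun p ↦ Real.sqrt (LinearMap.det
      ((D.metric.sharp p).toLinearMap ∘ₗ D₂.metric.toBilinForm p))) ∧
    ∀ p : X, (1 - |t| * C) ^ 3 ≤ LinearMap.det ((D.metric.sharp p).toLinearMap ∘ₗ D₂.metric.toBilinForm p) ∧
      LinearMap.det ((D.metric.sharp p).toLinearMap ∘ₗ D₂.metric.toBilinForm p) ≤ (1 + |t| * C) ^ 3 := by
  refine ⟨riemannianMeasure_eq_withDensity_sqrt_det_endo D₂.h D.h,
    continuous_sqrt_det_endo D₂.h D.h, fun p ↦ ?_⟩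
  have h := D.metric.det_sharp_comp_toBilinForm_mem_Icc p D.isRiemannian_metric D₂.metric ht
    (fun v ↦ (ricciFamily_val_mem_Icc D hC hval p v).1)
    (fun v ↦ (ricciFamily_val_mem_Icc D hC hval p v).2)
  rwa [finrank_euclideanSpace_fin] at h

end Family

namespace AFEnd

variable (e : AFEnd X) (D : InitialDataSet (𝓡 3) X) [T2Space X] [LocallyCompactSpace X]
  [SecondCountableTopology X] [MeasurableSpace X] [BorelSpace X]

/-! ### The package of uniform constants -/

/-- **Uniform constants along the Ricci variation** (Schoen–Yau 1979, p. 73: the estimates of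
Lemmas 3.1–3.2 for `ds²_t = ds² + t Ric` "hold uniformly for `t` small"). For data `D` on a
connected oriented one-ended `3`-manifold with `h − δ = o₅(r⁻²)` on the end and any family `D_t`,
`|t| < τ`, with metric `h + t Ric` pointwise, there are `τ₁ ∈ (0, τ]`, the bound `C ≥ 0` of
`|Ric(v,v)| ≤ C h(v,v)` with `τ₁ C ≤ 1/2`, and a constant `c₁ ≥ 0`, such that for every `|t| < τ₁`:
(i) `(1 − |t|C) h ≤ h_t ≤ (1 + |t|C) h`; (ii) `(1 − |t|C)³ ≤ det(♯_h ∘ ♭_{h_t}) ≤ (1 + |t|C)³` and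
`dV_t = √det(♯_h ∘ ♭_{h_t}) dV`; (iii) `dV_t ≤ 2 dV` and `dV ≤ 3 dV_t`; (iv) the Sobolev
inequality `(∫ |ζ|⁶ dV_t)^{1/3} ≤ c₁ ∫ h_t⁻¹(dζ, dζ) dV_t` for all `ζ ∈ C¹_c(X)`, with `c₁`
independent of `t` (Lemma 3.1 for `h` transferred by uniform equivalence).
[cite: SchoenYauPMT1979, Lemma 3.1 (p. 63) and (3.28)–(3.29) (p. 73)] -/
theorem exists_uniform_constants_ricciFamily [ConnectedSpace X] [D.metric.HasLeviCivita]
    (haf : e.IsStronglyAsymptoticallyFlatWith D 0 2 0 5 0) (hsole : e.IsSoleEnd)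
    {τ : ℝ} (hτ : 0 < τ) (Dt : ℝ → InitialDataSet (𝓡 3) X)
    (hval : ∀ t : ℝ, |t| < τ → ∀ (x : X) (v w : TangentSpace (𝓡 3) x),
      (Dt t).metric.val x v w = D.metric.val x v w + t * D.metric.ricci x v w) :
    ∃ (τ₁ C c₁ : ℝ), 0 < τ₁ ∧ τ₁ ≤ τ ∧ 0 ≤ C ∧ τ₁ * C ≤ 1 / 2 ∧ 0 ≤ c₁ ∧
      (∀ (x : X) (v : TangentSpace (𝓡 3) x), |D.metric.ricci x v v| ≤ C * D.metric.val x v v) ∧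
      ∀ t : ℝ, |t| < τ₁ →
        (∀ (x : X) (v : TangentSpace (𝓡 3) x),
          (1 - |t| * C) * D.metric.val x v v ≤ (Dt t).metric.val x v v ∧
            (Dt t).metric.val x v v ≤ (1 + |t| * C) * D.metric.val x v v) ∧
        (riemannianMeasure (Dt t).h = (riemannianMeasure D.h).withDensity (fun p ↦ ENNReal.ofReal
          (Real.sqrt (LinearMap.det
            ((D.metric.sharp p).toLinearMap ∘ₗ (Dt t).metric.toBilinForm p))))) ∧
        (∀ p : X, (1 - |t| * C) ^ 3 ≤
            LinearMap.det ((D.metric.sharp p).toLinearMap ∘ₗ (Dt t).metric.toBilinForm p) ∧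
          LinearMap.det ((D.metric.sharp p).toLinearMap ∘ₗ (Dt t).metric.toBilinForm p) ≤
            (1 + |t| * C) ^ 3) ∧
        riemannianMeasure (Dt t).h ≤ ENNReal.ofReal 2 • riemannianMeasure D.h ∧
        riemannianMeasure D.h ≤ ENNReal.ofReal 3 • riemannianMeasure (Dt t).h ∧
        (∀ ζ : X → ℝ, ContMDiff (𝓡 3) 𝓘(ℝ, ℝ) 1 ζ → HasCompactSupport ζ →
          (∫ x, |ζ x| ^ 6 ∂riemannianMeasure (Dt t).h) ^ (1 / 3 : ℝ) ≤
            c₁ * ∫ x, (Dt t).metric.innerDual x (mvfderiv (𝓡 3) ζ x).toLinearMap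
              (mvfderiv (𝓡 3) ζ x).toLinearMap ∂riemannianMeasure (Dt t).h) := by
  -- the global bound `|Ric(v,v)| ≤ C h(v,v)` and the radius `τ₁`
  obtain ⟨C, hC0, hC⟩ := e.exists_bound_abs_ricci_le D haf hsole
  set τ₁ : ℝ := min τ (1 / (2 * (C + 1))) with hτ₁
  have hτ₁0 : 0 < τ₁ := lt_min hτ (by positivity)
  have hτ₁τ : τ₁ ≤ τ := min_le_left _ _
  have hτ₁C : τ₁ * C ≤ 1 / 2 := by
    have h1 : τ₁ ≤ 1 / (2 * (C + 1)) := min_le_right _ _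
    have h2 : τ₁ * (C + 1) ≤ 1 / 2 := by
      rw [le_div_iff₀ (by positivity : (0 : ℝ) < 2 * (C + 1))] at h1
      linarith
    nlinarith [hτ₁0.le]
  -- the Sobolev constant of `h` (Lemma 3.1)
  have hAF : e.IsMetricAsymptoticallyFlat D 2 :=
    AFEnd.IsStronglyAsymptoticallyFlatWith.isMetricAsymptoticallyFlat_of_massZero e D haf
      (by norm_num)
  obtain ⟨c₀, hc₀0, hS⟩ := e.sobolev_inequality D two_pos hAF hsole
  set c₁ : ℝ := (2 : ℝ) ^ (1 / 3 : ℝ) * c₀ * 2 * 3 with hc₁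
  refine ⟨τ₁, C, c₁, hτ₁0, hτ₁τ, hC0, hτ₁C, by positivity, hC, fun t ht ↦ ?_⟩
  have htτ : |t| < τ := ht.trans_le hτ₁τ
  have htC : |t| * C ≤ 1 / 2 :=
    (mul_le_mul_of_nonneg_right ht.le hC0).trans hτ₁C
  have htC1 : |t| * C ≤ 1 := htC.trans (by norm_num)
  have hvt := hval t htτ
  haveI : (Dt t).metric.HasLeviCivita := (Dt t).metric.hasLeviCivita
  -- (i) pointwise comparison
  have hcomp := fun x v ↦ ricciFamily_val_mem_Icc D hC hvt x v
  -- (ii) density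
  obtain ⟨hdens, -, hdet⟩ := riemannianMeasure_ricciFamily_eq_withDensity D hC htC1 hvt
  -- (iii) measure comparison: `det ≤ (3/2)³ ≤ 4`, `det⁻¹ ≤ 8 ≤ 9`
  have hμ : riemannianMeasure (Dt t).h ≤ ENNReal.ofReal 2 • riemannianMeasure D.h := by
    refine riemannianMeasure_le_smul_of_det_endo_le (Dt t).h D.h zero_le_two fun p ↦ ?_
    have h1 := (hdet p).2
    have hs0 : 0 ≤ |t| * C := mul_nonneg (abs_nonneg t) hC0
    have h2 : (1 + |t| * C) ^ 3 ≤ (2 : ℝ) ^ 2 :=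
      (pow_le_pow_left₀ (by linarith) (show 1 + |t| * C ≤ 3 / 2 by linarith) 3).trans (by norm_num)
    exact h1.trans h2
  have hμ' : riemannianMeasure D.h ≤ ENNReal.ofReal 3 • riemannianMeasure (Dt t).h := by
    refine riemannianMeasure_le_smul_of_det_endo_le D.h (Dt t).h (by norm_num) fun p ↦ ?_
    have hswap := D.metric.det_sharp_comp_toBilinForm_mul_swap p (Dt t).metric
    have hlo := (hdet p).1
    have h18 : (1 / 8 : ℝ) ≤ (1 - |t| * C) ^ 3 :=
      le_trans (by norm_num) (pow_le_pow_left₀ (by norm_num) (show (1 / 2 : ℝ) ≤ 1 - |t| * C by linarith) 3)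
    have hpos : 0 < LinearMap.det ((D.metric.sharp p).toLinearMap ∘ₗ (Dt t).metric.toBilinForm p) :=
      by linarith
    have heq : LinearMap.det (((Dt t).metric.sharp p).toLinearMap ∘ₗ D.metric.toBilinForm p) =
        (LinearMap.det ((D.metric.sharp p).toLinearMap ∘ₗ (Dt t).metric.toBilinForm p))⁻¹ :=
      eq_inv_of_mul_eq_one_left hswap
    change LinearMap.det (((Dt t).metric.sharp p).toLinearMap ∘ₗ D.metric.toBilinForm p) ≤ 3 ^ 2
    rw [heq, inv_le_comm₀ hpos (by norm_num)]
    linarith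
  -- (iv) Sobolev transfer with `Λ = 2`, `C = 2`, `C' = 3`
  have hS' := sobolev_of_uniformlyEquivalent D (Dt t) (Λ := 2) (C := 2) (C' := 3) (c₁ := c₀)
    zero_le_two zero_le_two (by norm_num) hc₀0
    (fun x v ↦ (hcomp x v).2.trans (by
      have h0 : 0 ≤ D.metric.val x v v := by
        by_cases hv : v = 0
        · simp [hv]
        · exact (D.isRiemannian_metric x v hv).le
      nlinarith [abs_nonneg t]))
    hμ hμ' hS
  refine ⟨hcomp, hdens, hdet, hμ, hμ', fun ζ hζ hζc ↦ ?_⟩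
  have h := hS' ζ hζ hζc
  simp only [hc₁]
  exact h

end AFEnd

end Literature.Geometry.Lorentzian

end
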